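import Summits.QuantumFields.YangMills.Theorems.ColdStartUniversalityLatticeLangevinLiebRobinsonCorrelationLightConePointwise
import Summits.QuantumFields.YangMills.Theorems.ColdStartUniversalityLatticeLangevinLiebRobinsonThreePointClustering
import HarnessLib

/-!
# Route `ColdStartUniversality` (fixed-cut-off SZZ dynamics; LIEB–ROBINSON / LOCALITY package, file 38):
# ★★★ FACTORISATION OF STRING EXPECTATIONS FROM A DETERMINISTIC START — `E_x[∏ᵢ Fᵢ(U_t)] ≈ ∏ᵢ E_x[Fᵢ(U_t)]` inside the light cones

Helper file (seat `ym-line-csu-p1`, g32; `--supports stmt-QuantumFields-24809`).  The crux observables of the route are STRINGS (products)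
of loop observables.  From a deterministic start (the cold start) the expectation of a product of `n` mutually distant local observables
factorises, at EVERY coupling and volume, up to the pairwise light-cone errors of file 35 (`transition_covariance_abs_le_lightCone_of_separated`),
by induction on `n` (peel off the first factor; the remaining product is bounded by `M^n` and has the profile `M^n·Σᵢℓⁱ`):
* `abs_prod_coords_le`, `linkLipschitz_prod` — sup bound `M^n` and link-Lipschitz profile `M^n·Σᵢ ℓⁱ` of a product of `n` observables bounded
  by `M ≥ 1` with profiles `ℓⁱ ≥ 0`;
* ★★★ `transition_prod_sub_prod_abs_le_lightCone` — for `C³` `f₀, …, f_(n−1)` with `|fᵢ∘coords| ≤ M` (`M ≥ 1`), profiles `ℓⁱ` on link sets `Λᵢ`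
  PAIRWISE at cyclic sup-distance `≥ R+1`, every realising kernel family, every lattice time `t`, EVERY start `x`:
  `|κ_t(∏ᵢ Fᵢ)(x) − ∏ᵢ κ_tFᵢ(x)| ≤ 96·t·e^(2λt)·2^(−(R+1))·M^n·(Σᵢ Σ_e ℓⁱ_e)²`, `λ = (1300+4√2)|β'|` — no volume factor, every coupling;
* ★★★ `solution_prod_sub_prod_abs_le_lightCone` — the same along every strong solution from a deterministic start (the cold start `U_0 ≡ 1`);
* ★★★ `wilson_loopString_transition_sub_prod_abs_le_lightCone` — LOOP STRINGS: for loop words `w₀,…,w_(n−1)` pairwise at distance `≥ R+1`,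
  `|κ_t(∏ᵢ Re tr wᵢ)(x) − ∏ᵢ κ_t(Re tr wᵢ)(x)| ≤ 96·t·e^(2λt)·2^(−(R+1))·2^n·(2π Σᵢ |wᵢ|²)²` for every start — every coupling, every volume.
THEOREMS ONLY, no definition, no sorry; [folklore].  HONEST FRAMING: fixed cut-off; every coupling, but the cone slope `λ ∝ |β'|` is NOT
`K`-uniform in physical units along the route's scaling `β'_K = (γε_K)⁻¹/2 → ∞` (for Bałaban's unit-scale block-averaged loops both the loop
size and the separation are `∼ ε_K⁻¹` lattice units while `2λt ∼ s/(γε_K²)`); `UniformColdStartMixing` (24809) is NOT restated; no crux, rung or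
summit statement is proved; the Yang–Mills mass gap is NOT proved.
-/

set_option autoImplicit false

noncomputable section

namespace Summit.QuantumFields.YangMills.Theorems.ColdStartUniversality.LiebRobinson

open MeasureTheory ProbabilityTheory Matrix Complex Finset Filter Set Metric intervalIntegral
open scoped ComplexConjugate BigOperators Matrix NNReal ENNReal Topology
open Literature.Probability.Process Literature.MathematicalPhysics.QuantumFieldTheory
open Literature.MathematicalPhysics.QuantumFieldTheory.Balaban1983to89
open Literature.MathematicalPhysics.QuantumLattice (fundamentalRep fundamentalLatticeRep continuous_fundamentalRep fundamentalRep_apply)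

variable {L : ℕ} [NeZero L]

/-! ## §1. Products of bounded observables with link-Lipschitz profiles -/

omit [NeZero L] in
/-- **Sup bound of a product**: `|∏ᵢ Fᵢ(y)| ≤ M^n` if `|Fᵢ| ≤ M`. [folklore] -/
theorem abs_prod_coords_le {n : ℕ} {F : Fin n → (GaugeConfig 3 L (Matrix.specialUnitaryGroup (Fin 2) ℂ)) → ℝ} {M : ℝ} (hM : ∀ i y, |F i y| ≤ M) (y : (GaugeConfig 3 L (Matrix.specialUnitaryGroup (Fin 2) ℂ))) :
    |∏ i, F i y| ≤ M ^ n := by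
  rw [Finset.abs_prod]
  calc ∏ i, |F i y| ≤ ∏ _i : Fin n, M := Finset.prod_le_prod (fun i _ => abs_nonneg _) fun i _ => hM i y
    _ = M ^ n := by rw [Finset.prod_const, Finset.card_univ, Fintype.card_fin]

omit [NeZero L] in
/-- **Link-Lipschitz profile of a product**: if `|Fᵢ| ≤ M` with `M ≥ 1` and `Fᵢ` has profile `ℓⁱ ≥ 0` (Frobenius distance of the link
matrices, all other links frozen), then `∏ᵢ Fᵢ` has the profile `M^n·Σᵢ ℓⁱ`. [folklore] -/
theorem linkLipschitz_prod {n : ℕ} {F : Fin n → (GaugeConfig 3 L (Matrix.specialUnitaryGroup (Fin 2) ℂ)) → ℝ} {ℓ : Fin n → Edge 3 L → ℝ} {M : ℝ} (hM1 : 1 ≤ M)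
    (hM : ∀ i y, |F i y| ≤ M) (hℓ : ∀ i e, 0 ≤ ℓ i e)
    (hL : ∀ (i : Fin n) (e : Edge 3 L) (y y' : (GaugeConfig 3 L (Matrix.specialUnitaryGroup (Fin 2) ℂ))), (∀ f', f' ≠ e → y f' = y' f') →
      |F i y - F i y'| ≤ ℓ i e * frobNorm ((y e : Matrix (Fin 2) (Fin 2) ℂ) - (y' e : Matrix (Fin 2) (Fin 2) ℂ)))
    (e : Edge 3 L) (y y' : (GaugeConfig 3 L (Matrix.specialUnitaryGroup (Fin 2) ℂ))) (hyy' : ∀ f', f' ≠ e → y f' = y' f') :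
    |(∏ i, F i y) - ∏ i, F i y'| ≤ (M ^ n * ∑ i, ℓ i e) * frobNorm ((y e : Matrix (Fin 2) (Fin 2) ℂ) - (y' e : Matrix (Fin 2) (Fin 2) ℂ)) := by
  induction n with
  | zero => simp
  | succ n ih =>
    have hM0 : 0 ≤ M := zero_le_one.trans hM1
    set d : ℝ := frobNorm ((y e : Matrix (Fin 2) (Fin 2) ℂ) - (y' e : Matrix (Fin 2) (Fin 2) ℂ)) with hd
    have hd0 : 0 ≤ d := frobNorm_nonneg _
    have ihG : |(∏ i : Fin n, F i.succ y) - ∏ i : Fin n, F i.succ y'| ≤ (M ^ n * ∑ i : Fin n, ℓ i.succ e) * d :=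
      ih (fun i y => hM i.succ y) (fun i e => hℓ i.succ e) (fun i e y y' h => hL i.succ e y y' h)
    have hG : |∏ i : Fin n, F i.succ y'| ≤ M ^ n := abs_prod_coords_le (F := fun i => F i.succ) (fun i y => hM i.succ y) y'
    have h0 := hL 0 e y y' hyy'
    have hS0 : 0 ≤ ∑ i : Fin n, ℓ i.succ e := Finset.sum_nonneg fun i _ => hℓ i.succ e
    rw [Fin.prod_univ_succ, Fin.prod_univ_succ, Fin.sum_univ_succ]
    have hpow : M ^ n ≤ M ^ (n + 1) := pow_le_pow_right₀ hM1 (Nat.le_succ n)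
    calc |F 0 y * ∏ i : Fin n, F i.succ y - F 0 y' * ∏ i : Fin n, F i.succ y'|
        = |F 0 y * ((∏ i : Fin n, F i.succ y) - ∏ i : Fin n, F i.succ y') + (F 0 y - F 0 y') * ∏ i : Fin n, F i.succ y'| := by ring_nf
      _ ≤ |F 0 y * ((∏ i : Fin n, F i.succ y) - ∏ i : Fin n, F i.succ y')| + |(F 0 y - F 0 y') * ∏ i : Fin n, F i.succ y'| := abs_add_le _ _
      _ = |F 0 y| * |(∏ i : Fin n, F i.succ y) - ∏ i : Fin n, F i.succ y'| + |F 0 y - F 0 y'| * |∏ i : Fin n, F i.succ y'| := by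
          rw [abs_mul, abs_mul]
      _ ≤ M * ((M ^ n * ∑ i : Fin n, ℓ i.succ e) * d) + (ℓ 0 e * d) * M ^ n :=
          add_le_add (mul_le_mul (hM 0 y) ihG (abs_nonneg _) hM0) (mul_le_mul h0 hG (abs_nonneg _) ((abs_nonneg _).trans h0))
      _ = (M ^ (n + 1) * ∑ i : Fin n, ℓ i.succ e) * d + (M ^ n * ℓ 0 e) * d := by ring
      _ ≤ (M ^ (n + 1) * ∑ i : Fin n, ℓ i.succ e) * d + (M ^ (n + 1) * ℓ 0 e) * d := by
          have := mul_le_mul_of_nonneg_right (mul_le_mul_of_nonneg_right hpow (hℓ 0 e)) hd0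
          linarith
      _ = (M ^ (n + 1) * (ℓ 0 e + ∑ i : Fin n, ℓ i.succ e)) * d := by ring

/-! ## §2. Factorisation of product expectations from a deterministic start -/

/-- ★★★ **Factorisation of string expectations from EVERY deterministic start (every coupling `β'`, every volume `L`).**  Let
`f₀, …, f_(n−1)` be `C³` functions of the real link coordinates with `|fᵢ∘coords| ≤ M` (`M ≥ 1`) and link-Lipschitz profiles `ℓⁱ ≥ 0`
supported on link sets `Λᵢ` which are PAIRWISE at cyclic sup-distance `≥ R+1`.  Then for every realising Markov kernel family `κ`, every
lattice time `t` and every start `x`: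
`|κ_t(∏ᵢ fᵢ∘coords)(x) − ∏ᵢ κ_t(fᵢ∘coords)(x)| ≤ 96·t·e^(2λt)·2^(−(R+1))·M^n·(Σᵢ Σ_e ℓⁱ_e)²`, `λ = |β'|(4+4√2+12·108)`:
started from a point, the joint law of mutually distant observables stays a product law until the light cones meet.  Induction on `n`:
`κ_t(F₀·G) ≈ κ_tF₀·κ_tG` for the tail product `G` (file 35, profile `M^n Σᵢ≥₁ ℓⁱ` of `G`) and `|κ_tF₀| ≤ M`. [folklore] -/
theorem transition_prod_sub_prod_abs_le_lightCone (L : ℕ) [NeZero L] (β' : ℝ)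
    (κ : ℝ≥0 → Kernel (GaugeConfig 3 L (Matrix.specialUnitaryGroup (Fin 2) ℂ))
      (GaugeConfig 3 L (Matrix.specialUnitaryGroup (Fin 2) ℂ))) [∀ t, IsMarkovKernel (κ t)]
    (hreal : ∀ (t : ℝ≥0) (x : GaugeConfig 3 L (Matrix.specialUnitaryGroup (Fin 2) ℂ))
        (Ω : Type) [MeasurableSpace Ω] (P : Measure Ω) [IsProbabilityMeasure P]
        (W : ℝ≥0 → Ω → (Edge 3 L × NoiseIdx 2 → ℝ)) (hW : IsFlatBrownian W P)
        (U : ℝ≥0 → Ω → GaugeConfig 3 L (Matrix.specialUnitaryGroup (Fin 2) ℂ)),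
        (∀ ω, U 0 ω = x) →
        (latticeLangevinDynamics (fundamentalLatticeRep 2) β').IsSolution (fundamentalRep (Fin 2))
          hW.natFiltration P W U →
        κ t x = P.map (U t))
    {M : ℝ} (hM1 : 1 ≤ M) (R : ℕ) (t : ℝ≥0) (x : (GaugeConfig 3 L (Matrix.specialUnitaryGroup (Fin 2) ℂ))) (n : ℕ)
    (f : Fin n → (Edge 3 L × Fin 2 × Fin 2 × Bool → ℝ) → ℝ) (hf : ∀ i, ContDiff ℝ 3 (f i))
    (ℓ : Fin n → Edge 3 L → ℝ) (hℓ : ∀ i e, 0 ≤ ℓ i e) (Λ : Fin n → Finset (Edge 3 L)) (hΛ : ∀ i e, e ∉ Λ i → ℓ i e = 0)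
    (hsep : ∀ i j, i ≠ j → ∀ e ∈ Λ i, ∀ e' ∈ Λ j, R + 1 ≤ (Finset.univ.sup fun i : Fin 3 => ((e.1 i - e'.1 i).valMinAbs).natAbs)) :
    let coords : GaugeConfig 3 L (Matrix.specialUnitaryGroup (Fin 2) ℂ) → (Edge 3 L × Fin 2 × Fin 2 × Bool → ℝ) :=
      fun V q => (fun z : ℂ => if q.2.2.2 then z.im else z.re)
        ((fundamentalRep (Fin 2) (V q.1) : Matrix (Fin 2) (Fin 2) ℂ) q.2.1 q.2.2.1)
    (∀ i y, |f i (coords y)| ≤ M) →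
    (∀ (i : Fin n) (e : Edge 3 L) (y y' : (GaugeConfig 3 L (Matrix.specialUnitaryGroup (Fin 2) ℂ))), (∀ f', f' ≠ e → y f' = y' f') →
      |f i (coords y) - f i (coords y')| ≤ ℓ i e * frobNorm ((y e : Matrix (Fin 2) (Fin 2) ℂ) - (y' e : Matrix (Fin 2) (Fin 2) ℂ))) →
    |(∫ y, ∏ i, f i (coords y) ∂(κ t x)) - ∏ i, ∫ y, f i (coords y) ∂(κ t x)| ≤
      96 * (t : ℝ) * Real.exp (2 * ((|β'| * (4 + 4 * Real.sqrt 2 + 12 * 108)) * (t : ℝ))) * ((2 : ℝ)⁻¹) ^ (R + 1) * M ^ n * (∑ i, ∑ e : Edge 3 L, ℓ i e) ^ 2 := by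
  intro coords
  classical
  haveI := secondCountableTopology_su2
  haveI := borelSpace_config L
  have hco : Continuous coords := continuous_coords (L := L)
  set C : ℝ := 96 * (t : ℝ) * Real.exp (2 * ((|β'| * (4 + 4 * Real.sqrt 2 + 12 * 108)) * (t : ℝ))) * ((2 : ℝ)⁻¹) ^ (R + 1) with hC
  have hC0 : 0 ≤ C := by rw [hC]; positivity
  have hM0 : 0 ≤ M := zero_le_one.trans hM1
  induction n with
  | zero =>
    intro hMf hLf
    haveI : IsProbabilityMeasure (κ t x) := IsMarkovKernel.isProbabilityMeasure x
    simp only [Finset.univ_eq_empty, Finset.prod_empty, Finset.sum_empty, MeasureTheory.integral_const, smul_eq_mul, mul_one,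
      probReal_univ, sub_self, abs_zero]
    positivity
  | succ n ih =>
    intro hMf hLf
    haveI : IsProbabilityMeasure (κ t x) := IsMarkovKernel.isProbabilityMeasure x
    -- the tail data
    have ihT := ih (fun i => f i.succ) (fun i => hf i.succ) (fun i => ℓ i.succ) (fun i e => hℓ i.succ e) (fun i => Λ i.succ)
      (fun i e he => hΛ i.succ e he) (fun i j hij e he e' he' => hsep i.succ j.succ (fun h => hij (Fin.succ_injective _ h)) e he e' he')
      (fun i y => hMf i.succ y) (fun i e y y' h => hLf i.succ e y y' h)
    set S0 : ℝ := ∑ e : Edge 3 L, ℓ 0 e with hS0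
    set T : ℝ := ∑ i : Fin n, ∑ e : Edge 3 L, ℓ i.succ e with hT
    have hS00 : 0 ≤ S0 := Finset.sum_nonneg fun e _ => hℓ 0 e
    have hT0 : 0 ≤ T := Finset.sum_nonneg fun i _ => Finset.sum_nonneg fun e _ => hℓ i.succ e
    -- the tail product as one observable: `C³`, bounded by `M^n`, profile `M^n Σᵢ≥₁ ℓⁱ` on `⋃ᵢ≥₁ Λᵢ`
    set g : (Edge 3 L × Fin 2 × Fin 2 × Bool → ℝ) → ℝ := fun z => ∏ i : Fin n, f i.succ z with hg
    have hgC : ContDiff ℝ 3 g := contDiff_prod fun i _ => hf i.succ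
    set ℓG : Edge 3 L → ℝ := fun e => M ^ n * ∑ i : Fin n, ℓ i.succ e with hℓG
    have hℓG0 : ∀ e, 0 ≤ ℓG e := fun e => mul_nonneg (pow_nonneg hM0 n) (Finset.sum_nonneg fun i _ => hℓ i.succ e)
    set ΛG : Finset (Edge 3 L) := Finset.univ.biUnion fun i : Fin n => Λ i.succ with hΛG
    have hΛG0 : ∀ e, e ∉ ΛG → ℓG e = 0 := by
      intro e he
      have hz : ∀ i : Fin n, ℓ i.succ e = 0 := fun i => hΛ i.succ e fun hmem => he (Finset.mem_biUnion.2 ⟨i, Finset.mem_univ _, hmem⟩)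
      simp only [hℓG, hz, Finset.sum_const_zero, mul_zero]
    have hsep0 : ∀ e' ∈ Λ 0, ∀ e ∈ ΛG, R + 1 ≤ (Finset.univ.sup fun i : Fin 3 => ((e'.1 i - e.1 i).valMinAbs).natAbs) := by
      intro e' he' e he
      obtain ⟨j, -, hj⟩ := Finset.mem_biUnion.1 he
      exact hsep 0 j.succ (Fin.succ_ne_zero j).symm e' he' e hj
    have hLg : ∀ (e : Edge 3 L) (y y' : (GaugeConfig 3 L (Matrix.specialUnitaryGroup (Fin 2) ℂ))), (∀ f', f' ≠ e → y f' = y' f') →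
        |g (coords y) - g (coords y')| ≤ ℓG e * frobNorm ((y e : Matrix (Fin 2) (Fin 2) ℂ) - (y' e : Matrix (Fin 2) (Fin 2) ℂ)) :=
      fun e y y' h => linkLipschitz_prod (F := fun i y => f i.succ (coords y)) (ℓ := fun i => ℓ i.succ) hM1 (fun i y => hMf i.succ y)
        (fun i e => hℓ i.succ e) (fun i e y y' h => hLf i.succ e y y' h) e y y' h
    -- (i) peel off the first factor: file 35
    have h35 := transition_covariance_abs_le_lightCone_of_separated L β' κ hreal (hf 0) (hℓ 0) hgC hℓG0 (Λ 0) ΛG (fun e he => hΛ 0 e he) hΛG0 R hsep0 t x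
      (fun e y y' h => hLf 0 e y y' h) hLg
    have hsumG : ∑ e : Edge 3 L, ℓG e = M ^ n * T := by
      rw [hℓG, hT, ← Finset.mul_sum, Finset.sum_comm]
    -- (ii) the first factor is bounded by `M`
    have hB : |∫ y, f 0 (coords y) ∂(κ t x)| ≤ M :=
      abs_integral_le_of_abs_le_of_isProbabilityMeasure (μ := κ t x) (fun y => hMf 0 y)
    -- assemble
    have eprod : ∀ y : (GaugeConfig 3 L (Matrix.specialUnitaryGroup (Fin 2) ℂ)), ∏ i : Fin (n + 1), f i (coords y) = f 0 (coords y) * g (coords y) := fun y => by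
      rw [Fin.prod_univ_succ]
    have eP : ∏ i : Fin (n + 1), ∫ y, f i (coords y) ∂(κ t x) = (∫ y, f 0 (coords y) ∂(κ t x)) * ∏ i : Fin n, ∫ y, f i.succ (coords y) ∂(κ t x) := by
      rw [Fin.prod_univ_succ]
    have eS : ∑ i : Fin (n + 1), ∑ e : Edge 3 L, ℓ i e = S0 + T := by rw [Fin.sum_univ_succ]
    have eI : ∫ y, ∏ i : Fin (n + 1), f i (coords y) ∂(κ t x) = ∫ y, f 0 (coords y) * g (coords y) ∂(κ t x) :=
      integral_congr_ae (ae_of_all _ fun y => eprod y)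
    rw [eI, eP, eS]
    set A : ℝ := ∫ y, f 0 (coords y) * g (coords y) ∂(κ t x) with hA
    set B : ℝ := ∫ y, f 0 (coords y) ∂(κ t x) with hB'
    set Cg : ℝ := ∫ y, g (coords y) ∂(κ t x) with hCg
    set P : ℝ := ∏ i : Fin n, ∫ y, f i.succ (coords y) ∂(κ t x) with hP
    have h1 : |A - B * Cg| ≤ C * S0 * (M ^ n * T) := by
      have := h35; rw [hsumG] at this
      calc |A - B * Cg| ≤ 96 * (t : ℝ) * Real.exp (2 * ((|β'| * (4 + 4 * Real.sqrt 2 + 12 * 108)) * (t : ℝ))) * ((2 : ℝ)⁻¹) ^ (R + 1) * (∑ e : Edge 3 L, ℓ 0 e) * (M ^ n * T) := this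
        _ = C * S0 * (M ^ n * T) := by rw [hC, hS0]
    have h2 : |Cg - P| ≤ C * M ^ n * T ^ 2 := ihT
    have hsplit : |A - B * P| ≤ |A - B * Cg| + |B| * |Cg - P| := by
      calc |A - B * P| = |(A - B * Cg) + B * (Cg - P)| := by ring_nf
        _ ≤ |A - B * Cg| + |B * (Cg - P)| := abs_add_le _ _
        _ = |A - B * Cg| + |B| * |Cg - P| := by rw [abs_mul]
    have h3 : |B| * |Cg - P| ≤ M * (C * M ^ n * T ^ 2) := mul_le_mul hB h2 (abs_nonneg _) hM0
    have hpow : M ^ n ≤ M ^ (n + 1) := pow_le_pow_right₀ hM1 (Nat.le_succ n)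
    have h4 : C * S0 * (M ^ n * T) ≤ C * M ^ (n + 1) * (S0 * T) := by
      have := mul_le_mul_of_nonneg_left hpow (mul_nonneg (mul_nonneg hC0 hS00) hT0)
      calc C * S0 * (M ^ n * T) = C * S0 * T * M ^ n := by ring
        _ ≤ C * S0 * T * M ^ (n + 1) := this
        _ = C * M ^ (n + 1) * (S0 * T) := by ring
    have h5 : M * (C * M ^ n * T ^ 2) = C * M ^ (n + 1) * T ^ 2 := by ring
    have hk : 0 ≤ C * M ^ (n + 1) := mul_nonneg hC0 (pow_nonneg hM0 _)
    calc |A - B * P| ≤ C * M ^ (n + 1) * (S0 * T) + C * M ^ (n + 1) * T ^ 2 := by linarith [hsplit, h1, h3, h4, h5]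
      _ = C * M ^ (n + 1) * (S0 * T + T ^ 2) := by ring
      _ ≤ C * M ^ (n + 1) * (S0 + T) ^ 2 := mul_le_mul_of_nonneg_left (by nlinarith [mul_nonneg hS00 hT0, sq_nonneg S0]) hk

/-- ★★★ **Factorisation ALONG EVERY SZZ SOLUTION from a deterministic start** (e.g. the COLD START `U_0 ≡ 1`; any filtered probability
space, any flat Brownian driver, every coupling, every volume): with the data of `transition_prod_sub_prod_abs_le_lightCone`,
`|E[∏ᵢ fᵢ(coords U_t)] − ∏ᵢ E[fᵢ(coords U_t)]| ≤ 96·t·e^(2λt)·2^(−(R+1))·M^n·(Σᵢ Σ_e ℓⁱ_e)²`.  Fixed cut-off; `UniformColdStartMixing` (24809) is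
NOT restated; the Yang–Mills mass gap is NOT proved. [folklore] -/
theorem solution_prod_sub_prod_abs_le_lightCone (L : ℕ) [NeZero L] (β' : ℝ) {M : ℝ} (hM1 : 1 ≤ M) (R : ℕ) (t : ℝ≥0)
    (x₀ : (GaugeConfig 3 L (Matrix.specialUnitaryGroup (Fin 2) ℂ))) (Ω : Type) [MeasurableSpace Ω] (P : Measure Ω) [IsProbabilityMeasure P]
    (W : ℝ≥0 → Ω → (Edge 3 L × NoiseIdx 2 → ℝ)) (hW : IsFlatBrownian W P)
    (U : ℝ≥0 → Ω → (GaugeConfig 3 L (Matrix.specialUnitaryGroup (Fin 2) ℂ))) (hU0 : ∀ ω, U 0 ω = x₀)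
    (hU : (latticeLangevinDynamics (fundamentalLatticeRep 2) β').IsSolution (fundamentalRep (Fin 2)) hW.natFiltration P W U) (n : ℕ)
    (f : Fin n → (Edge 3 L × Fin 2 × Fin 2 × Bool → ℝ) → ℝ) (hf : ∀ i, ContDiff ℝ 3 (f i))
    (ℓ : Fin n → Edge 3 L → ℝ) (hℓ : ∀ i e, 0 ≤ ℓ i e) (Λ : Fin n → Finset (Edge 3 L)) (hΛ : ∀ i e, e ∉ Λ i → ℓ i e = 0)
    (hsep : ∀ i j, i ≠ j → ∀ e ∈ Λ i, ∀ e' ∈ Λ j, R + 1 ≤ (Finset.univ.sup fun i : Fin 3 => ((e.1 i - e'.1 i).valMinAbs).natAbs)) :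
    let coords : GaugeConfig 3 L (Matrix.specialUnitaryGroup (Fin 2) ℂ) → (Edge 3 L × Fin 2 × Fin 2 × Bool → ℝ) :=
      fun V q => (fun z : ℂ => if q.2.2.2 then z.im else z.re)
        ((fundamentalRep (Fin 2) (V q.1) : Matrix (Fin 2) (Fin 2) ℂ) q.2.1 q.2.2.1)
    (∀ i y, |f i (coords y)| ≤ M) →
    (∀ (i : Fin n) (e : Edge 3 L) (y y' : (GaugeConfig 3 L (Matrix.specialUnitaryGroup (Fin 2) ℂ))), (∀ f', f' ≠ e → y f' = y' f') →
      |f i (coords y) - f i (coords y')| ≤ ℓ i e * frobNorm ((y e : Matrix (Fin 2) (Fin 2) ℂ) - (y' e : Matrix (Fin 2) (Fin 2) ℂ))) →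
    |(∫ ω, ∏ i, f i (coords (U t ω)) ∂P) - ∏ i, ∫ ω, f i (coords (U t ω)) ∂P| ≤
      96 * (t : ℝ) * Real.exp (2 * ((|β'| * (4 + 4 * Real.sqrt 2 + 12 * 108)) * (t : ℝ))) * ((2 : ℝ)⁻¹) ^ (R + 1) * M ^ n * (∑ i, ∑ e : Edge 3 L, ℓ i e) ^ 2 := by
  intro coords hMf hLf
  classical
  haveI := secondCountableTopology_su2
  haveI := borelSpace_config L
  obtain ⟨κ, hκ, -, hreal⟩ := exists_transitionKernel L β'
  haveI := hκ
  have h := transition_prod_sub_prod_abs_le_lightCone L β' κ hreal hM1 R t x₀ n f hf ℓ hℓ Λ hΛ hsep hMf hLf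
  have hlaw : κ t x₀ = P.map (U t) := hreal t x₀ Ω P W hW U hU0 hU
  have hmU : Measurable (U t) := (hU.adapted t).mono (hW.natFiltration.le t) le_rfl
  have hco : Continuous coords := continuous_coords (L := L)
  have hFm : ∀ i, Measurable fun y : (GaugeConfig 3 L (Matrix.specialUnitaryGroup (Fin 2) ℂ)) => f i (coords y) := fun i => ((hf i).continuous.comp hco).measurable
  have hPm : Measurable fun y : (GaugeConfig 3 L (Matrix.specialUnitaryGroup (Fin 2) ℂ)) => ∏ i, f i (coords y) := Finset.measurable_prod _ fun i _ => hFm i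
  have e1 : ∫ y, ∏ i, f i (coords y) ∂(κ t x₀) = ∫ ω, ∏ i, f i (coords (U t ω)) ∂P := by
    rw [hlaw, integral_map hmU.aemeasurable hPm.aestronglyMeasurable]
  have e2 : ∀ i, ∫ y, f i (coords y) ∂(κ t x₀) = ∫ ω, f i (coords (U t ω)) ∂P := fun i => by
    rw [hlaw, integral_map hmU.aemeasurable (hFm i).aestronglyMeasurable]
  rw [← e1]
  simp_rw [← e2]
  exact h

/-! ## §3. Loop strings -/

/-- ★★★ **LOOP STRINGS FROM THE COLD START FACTORISE INSIDE THE LIGHT CONES (every coupling, every volume).**  For loop words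
`w₀, …, w_(n−1)` (lists of oriented links) whose link sets are PAIRWISE at cyclic sup-distance `≥ R+1`, every realising kernel family, every
lattice time `t` and every start `x` (e.g. the cold start):
`|κ_t(∏ᵢ Re tr wᵢ)(x) − ∏ᵢ κ_t(Re tr wᵢ)(x)| ≤ 96·t·e^(2λt)·2^(−(R+1))·2^n·(2π·Σᵢ |wᵢ|²)²`, `λ = (1300+4√2)|β'|`
(`transition_prod_sub_prod_abs_le_lightCone` with `M = 2`, `|Re tr w| ≤ 2`, word profiles `2π|w|` on the links of `w`, `Σ_e ℓ^w_e ≤ 2π|w|²`).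
Fixed cut-off; the Yang–Mills mass gap is NOT proved. [folklore] -/
theorem wilson_loopString_transition_sub_prod_abs_le_lightCone (L : ℕ) [NeZero L] (β' : ℝ)
    (κ : ℝ≥0 → Kernel (GaugeConfig 3 L (Matrix.specialUnitaryGroup (Fin 2) ℂ))
      (GaugeConfig 3 L (Matrix.specialUnitaryGroup (Fin 2) ℂ))) [∀ t, IsMarkovKernel (κ t)]
    (hreal : ∀ (t : ℝ≥0) (x : GaugeConfig 3 L (Matrix.specialUnitaryGroup (Fin 2) ℂ))
        (Ω : Type) [MeasurableSpace Ω] (P : Measure Ω) [IsProbabilityMeasure P]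
        (W : ℝ≥0 → Ω → (Edge 3 L × NoiseIdx 2 → ℝ)) (hW : IsFlatBrownian W P)
        (U : ℝ≥0 → Ω → GaugeConfig 3 L (Matrix.specialUnitaryGroup (Fin 2) ℂ)),
        (∀ ω, U 0 ω = x) →
        (latticeLangevinDynamics (fundamentalLatticeRep 2) β').IsSolution (fundamentalRep (Fin 2))
          hW.natFiltration P W U →
        κ t x = P.map (U t))
    (n : ℕ) (l : Fin n → List (Edge 3 L × Bool)) (R : ℕ)
    (hsep : ∀ i j, i ≠ j → ∀ e ∈ ((l i).map Prod.fst).toFinset, ∀ e' ∈ ((l j).map Prod.fst).toFinset, R + 1 ≤ (Finset.univ.sup fun i : Fin 3 => ((e.1 i - e'.1 i).valMinAbs).natAbs))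
    (t : ℝ≥0) (x : (GaugeConfig 3 L (Matrix.specialUnitaryGroup (Fin 2) ℂ))) :
    let coords : GaugeConfig 3 L (Matrix.specialUnitaryGroup (Fin 2) ℂ) → (Edge 3 L × Fin 2 × Fin 2 × Bool → ℝ) :=
      fun V q => (fun z : ℂ => if q.2.2.2 then z.im else z.re)
        ((fundamentalRep (Fin 2) (V q.1) : Matrix (Fin 2) (Fin 2) ℂ) q.2.1 q.2.2.1)
    |(∫ y, ∏ i, (fun (i : Fin n) (y : (Edge 3 L × Fin 2 × Fin 2 × Bool → ℝ)) => (((l i).map (fun a : Edge 3 L × Bool => if a.2 then ((fun (ee : Edge 3 L) => Matrix.of fun (i j : Fin 2) => ((y (ee, i, j, false) : ℝ) : ℂ) + ((y (ee, i, j, true) : ℝ) : ℂ) * Complex.I) a.1)ᴴ else (fun (ee : Edge 3 L) => Matrix.of fun (i j : Fin 2) => ((y (ee, i, j, false) : ℝ) : ℂ) + ((y (ee, i, j, true) : ℝ) : ℂ) * Complex.I) a.1)).prod).trace.re) i (coords y) ∂(κ t x)) - ∏ i, ∫ y, (fun (i : Fin n) (y : (Edge 3 L × Fin 2 × Fin 2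 × Bool → ℝ)) => (((l i).map (fun a : Edge 3 L × Bool => if a.2 then ((fun (ee : Edge 3 L) => Matrix.of fun (i j : Fin 2) => ((y (ee, i, j, false) : ℝ) : ℂ) + ((y (ee, i, j, true) : ℝ) : ℂ) * Complex.I) a.1)ᴴ else (fun (ee : Edge 3 L) => Matrix.of fun (i j : Fin 2) => ((y (ee, i, j, false) : ℝ) : ℂ) + ((y (ee, i, j, true) : ℝ) : ℂ) * Complex.I) a.1)).prod).trace.re) i (coords y) ∂(κ t x)| ≤
      96 * (t : ℝ) * Real.exp (2 * ((|β'| * (4 + 4 * Real.sqrt 2 + 12 * 108)) * (t : ℝ))) * ((2 : ℝ)⁻¹) ^ (R + 1) * 2 ^ n * (2 * Real.pi * ∑ i, ((l i).length : ℝ) ^ 2) ^ 2 := by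
  intro coords
  classical
  set ℓ : Fin n → Edge 3 L → ℝ := fun i e => if e ∈ ((l i).map Prod.fst).toFinset then 2 * Real.pi * ((l i).length : ℝ) else 0 with hℓ
  have hℓ0 : ∀ i e, 0 ≤ ℓ i e := fun i e => by
    simp only [hℓ]; split_ifs
    · positivity
    · exact le_rfl
  have hΛ : ∀ i e, e ∉ ((l i).map Prod.fst).toFinset → ℓ i e = 0 := fun i e he => by simp only [hℓ, he, if_false]
  have hLf := fun i : Fin n => word_linkLipschitz_profile L β' (l i)
  have hBf := fun (i : Fin n) (y : (GaugeConfig 3 L (Matrix.specialUnitaryGroup (Fin 2) ℂ))) => abs_word_le_two (L := L) (l i) y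
  have key := transition_prod_sub_prod_abs_le_lightCone L β' κ hreal (M := 2) (by norm_num) R t x n (fun i => (fun (i : Fin n) (y : (Edge 3 L × Fin 2 × Fin 2 × Bool → ℝ)) => (((l i).map (fun a : Edge 3 L × Bool => if a.2 then ((fun (ee : Edge 3 L) => Matrix.of fun (i j : Fin 2) => ((y (ee, i, j, false) : ℝ) : ℂ) + ((y (ee, i, j, true) : ℝ) : ℂ) * Complex.I) a.1)ᴴ else (fun (ee : Edge 3 L) => Matrix.of fun (i j : Fin 2) => ((y (ee, i, j, false) : ℝ) : ℂ) + ((y (ee, i, j, true) : ℝ) : ℂ) * Complex.I) a.1)).prod).trace.re) i)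
    (fun i => contDiff_word (L := L) (l i) (m := 3)) ℓ hℓ0 (fun i => ((l i).map Prod.fst).toFinset) hΛ hsep
    (fun i y => hBf i y) (fun i e y y' h => hLf i e y y' h)
  refine key.trans ?_
  have hS : ∑ i, ∑ e : Edge 3 L, ℓ i e ≤ 2 * Real.pi * ∑ i, ((l i).length : ℝ) ^ 2 := by
    rw [Finset.mul_sum]
    exact Finset.sum_le_sum fun i _ => sum_word_profile_le (L := L) (l i)
  have hS0 : 0 ≤ ∑ i, ∑ e : Edge 3 L, ℓ i e := Finset.sum_nonneg fun i _ => Finset.sum_nonneg fun e _ => hℓ0 i e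
  have hpre : 0 ≤ 96 * (t : ℝ) * Real.exp (2 * ((|β'| * (4 + 4 * Real.sqrt 2 + 12 * 108)) * (t : ℝ))) * ((2 : ℝ)⁻¹) ^ (R + 1) * 2 ^ n := by positivity
  exact mul_le_mul_of_nonneg_left (pow_le_pow_left₀ hS0 hS 2) hpre

end Summit.QuantumFields.YangMills.Theorems.ColdStartUniversality.LiebRobinson

end
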